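import Mathlib
import HarnessLib
import Summits.Ventures.LatticeQCDFlow.Exactness.LatentReversibleProposals

/-!
# LatticeQCDFlow / Exactness — THE GAUSSIAN CRANK–NICOLSON (AUTOREGRESSIVE) LATENT MOVE IS REVERSIBLE FOR THE GAUSSIAN BASE, so the
# partial latent refresh `z′ = ρz + √(1 − ρ²)·ξ`, read through a flow and accepted with the plain importance ratio, is exact

HONEST FRAMING: exact (Metropolis-corrected) sampling algorithms for lattice gauge theory;
figures of merit are autocorrelation/cost numbers at stated couplings and volumes; no
continuum-physics claim.

Venture `LatticeQCDFlow` (cell pub-lqcd), topic `Exactness`, FANOUT row 30 (lean-1 GEN-43, part II: MOVES IN FLOW SPACE; supplies the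
`γ`-reversibility hypothesis of `LatentReversibleProposals` for the one Gaussian latent coordinate).  NEW WORK of the cell over Mathlib's
`gaussianReal` ∕ `gaussianPDFReal`; no definition is introduced, nothing is cited as a fact.  Printed counterparts NAMED ONLY: the pCN
proposal (Cotter–Roberts–Stuart–White 2013; Neal 1998 "partial momentum refreshment" is the same autoregression); detailed balance of the
Gaussian AR(1) kernel is classical.

## Setting and results [all ours]

Latent coordinate `z ∈ ℝ` with base law `γ = N(0, 1)` (`gaussianReal 0 1`); autoregression parameter `ρ` with `ρ² < 1`, innovation variance
`v = 1 − ρ²`; the CRANK–NICOLSON MOVE, def-free: ANY kernel `S` on `ℝ` with `S(z, ·) = N(ρz, 1 − ρ²)` (hypothesis `hS`).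

* **`gaussianPDFReal_crankNicolson_symm`**: `φ(z)·φ_{ρz, 1−ρ²}(z′) = φ(z′)·φ_{ρz′, 1−ρ²}(z)` — the joint density of (state, proposal) is
  symmetric (the exponent is `−(z² + z′² − 2ρzz′)/(2(1 − ρ²))`).
* **`crankNicolson_isReversible`**: `S` is reversible for `N(0, 1)` (Tonelli on the symmetric joint density).
* **`crankNicolsonProposal_invariant`**: for every flow bijection `e : ℝ ≃ᵐ Ω` with flow law `q = N(0,1).map e` and every positive
  measurable weight `w`, ANY kernel realising "pull back, move `z ↦ ρz + √(1 − ρ²)ξ`, push forward, accept with `min(1, w(y)/w(x))`, else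
  stay" leaves `π = w·q` invariant (`LatentReversibleProposals.latentProposal_invariant`).

Not here: the `d`-dimensional latent Gaussian (the move acts coordinatewise; the product of reversible kernels is reversible for the product
law — not typed here), tuning of `ρ`.
-/

namespace Summit.Ventures.LatticeQCDFlow.Exactness

open MeasureTheory ProbabilityTheory Real
open scoped ENNReal NNReal

/-! ## §1 The joint density of (state, Crank–Nicolson proposal) is symmetric -/

/-- **`φ(z)·φ_{ρz,v}(z′) = φ(z′)·φ_{ρz′,v}(z)` for `v = 1 − ρ²`.** [ours] -/
theorem gaussianPDFReal_crankNicolson_symm {ρ : ℝ} {v : ℝ≥0} (hv : (v : ℝ) = 1 - ρ ^ 2) (hv0 : v ≠ 0) (z z' : ℝ) :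
    gaussianPDFReal 0 1 z * gaussianPDFReal (ρ * z) v z' = gaussianPDFReal 0 1 z' * gaussianPDFReal (ρ * z') v z := by
  have hvR : (v : ℝ) ≠ 0 := by exact_mod_cast hv0
  have hexp : -(z - 0) ^ 2 / (2 * ((1 : ℝ≥0) : ℝ)) + -(z' - ρ * z) ^ 2 / (2 * (v : ℝ)) =
      -(z' - 0) ^ 2 / (2 * ((1 : ℝ≥0) : ℝ)) + -(z - ρ * z') ^ 2 / (2 * (v : ℝ)) := by
    rw [NNReal.coe_one]
    field_simp
    rw [hv]
    ring
  simp only [gaussianPDFReal]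
  rw [mul_mul_mul_comm, ← Real.exp_add, hexp, Real.exp_add, mul_mul_mul_comm]

/-- The same for the `ℝ≥0∞` densities. [ours, bookkeeping] -/
theorem gaussianPDF_crankNicolson_symm {ρ : ℝ} {v : ℝ≥0} (hv : (v : ℝ) = 1 - ρ ^ 2) (hv0 : v ≠ 0) (z z' : ℝ) :
    gaussianPDF 0 1 z * gaussianPDF (ρ * z) v z' = gaussianPDF 0 1 z' * gaussianPDF (ρ * z') v z := by
  simp only [gaussianPDF]
  rw [← ENNReal.ofReal_mul (gaussianPDFReal_nonneg _ _ _), ← ENNReal.ofReal_mul (gaussianPDFReal_nonneg _ _ _),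
    gaussianPDFReal_crankNicolson_symm hv hv0]

/-- Joint measurability of `(z, z′) ↦ φ_{ρz, v}(z′)`. [ours, bookkeeping] -/
theorem measurable_gaussianPDF_crankNicolson (ρ : ℝ) (v : ℝ≥0) :
    Measurable (Function.uncurry fun z z' : ℝ => gaussianPDF (ρ * z) v z') :=
  measurable_uncurry_gaussianPDF.comp ((measurable_fst.const_mul ρ).prodMk (measurable_const.prodMk measurable_snd))

/-! ## §2 The Crank–Nicolson kernel is reversible for `N(0, 1)` -/

/-- **THE CRANK–NICOLSON LATENT MOVE IS `N(0,1)`-REVERSIBLE**: for ANY kernel `S` with `S(z, ·) = N(ρz, 1 − ρ²)`,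
`∫_A S(z, B) dN(0,1) = ∫_B S(z, A) dN(0,1)`. [ours] -/
theorem crankNicolson_isReversible {ρ : ℝ} {v : ℝ≥0} (hv : (v : ℝ) = 1 - ρ ^ 2) (hv0 : v ≠ 0) (S : Kernel ℝ ℝ)
    (hS : ∀ (z : ℝ) {B : Set ℝ}, MeasurableSet B → S z B = gaussianReal (ρ * z) v B) :
    Kernel.IsReversible S (gaussianReal 0 1) := by
  have hj := measurable_gaussianPDF_crankNicolson ρ v
  have key : ∀ {A B : Set ℝ}, MeasurableSet A → MeasurableSet B →
      ∫⁻ z in A, S z B ∂(gaussianReal 0 1) = ∫⁻ z in A, ∫⁻ z' in B, gaussianPDF 0 1 z * gaussianPDF (ρ * z) v z' := by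
    intro A B hA hB
    have hI : Measurable fun z => ∫⁻ z' in B, gaussianPDF (ρ * z) v z' := by
      have : Measurable fun z => ∫⁻ z', B.indicator (fun z' => gaussianPDF (ρ * z) v z') z' :=
        (hj.indicator (measurable_snd hB) :
          Measurable fun p : ℝ × ℝ => B.indicator (fun z' => gaussianPDF (ρ * p.1) v z') p.2).lintegral_prod_right'
      simpa only [lintegral_indicator hB] using this
    simp_rw [hS _ hB, gaussianReal_apply _ hv0]
    rw [gaussianReal_of_var_ne_zero 0 one_ne_zero, setLIntegral_withDensity_eq_setLIntegral_mul _ (measurable_gaussianPDF 0 1) hI hA]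
    refine lintegral_congr fun z => ?_
    rw [Pi.mul_apply, lintegral_const_mul _ (hj.of_uncurry_left)]
  intro A B hA hB
  rw [key hA hB, key hB hA]
  have hF : Measurable (Function.uncurry fun z z' : ℝ => gaussianPDF 0 1 z * gaussianPDF (ρ * z) v z') :=
    ((measurable_gaussianPDF 0 1).comp measurable_fst).mul hj
  rw [lintegral_lintegral_swap (hF.aemeasurable (μ := (volume.restrict A).prod (volume.restrict B)))]
  refine lintegral_congr fun z' => lintegral_congr fun z => ?_
  exact gaussianPDF_crankNicolson_symm hv hv0 z z'

/-- Such a kernel exists and is Markov (`Kernel` built from the measurable family `z ↦ N(ρz, v)`). [ours, remark] -/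
theorem crankNicolsonKernel_exists (ρ : ℝ) (v : ℝ≥0) :
    ∃ S : Kernel ℝ ℝ, IsMarkovKernel S ∧ ∀ (z : ℝ) {B : Set ℝ}, MeasurableSet B → S z B = gaussianReal (ρ * z) v B := by
  have hm : Measurable fun z : ℝ => gaussianReal (ρ * z) v :=
    measurable_gaussianReal.comp ((measurable_id.const_mul ρ).prodMk measurable_const)
  exact ⟨⟨fun z => gaussianReal (ρ * z) v, hm⟩, ⟨fun z => by
    show IsProbabilityMeasure (gaussianReal (ρ * z) v); infer_instance⟩, fun z _ _ => rfl⟩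

/-! ## §3 The Crank–Nicolson move through a flow, accepted with the plain ratio, is exact -/

variable {Ω : Type*} [MeasurableSpace Ω] {w : Ω → ℝ}

/-- **THE LATENT CRANK–NICOLSON FLOW SAMPLER IS EXACT**: flow bijection `e : ℝ ≃ᵐ Ω`, flow law `q = N(0,1).map e`, weight `w > 0`;
pull back, move `z ↦ ρz + √(1 − ρ²)ξ`, push forward, accept with `min(1, w(y)/w(x))`: `π = w·q` is invariant. [ours] -/
theorem crankNicolsonProposal_invariant {ρ : ℝ} {v : ℝ≥0} (hv : (v : ℝ) = 1 - ρ ^ 2) (hv0 : v ≠ 0)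
    (hw : Measurable w) (hw0 : ∀ x, 0 < w x) (e : ℝ ≃ᵐ Ω) (S : Kernel ℝ ℝ) [IsMarkovKernel S]
    (hS : ∀ (z : ℝ) {B : Set ℝ}, MeasurableSet B → S z B = gaussianReal (ρ * z) v B) (R : Kernel Ω Ω)
    (hR : ∀ (x : Ω) {B : Set Ω}, MeasurableSet B → R x B = S (e.symm x) (e ⁻¹' B)) (K : Kernel Ω Ω)
    (hK : ∀ (x : Ω) {B : Set Ω}, MeasurableSet B → K x B =
      ∫⁻ y in B, imhAcceptE w x y ∂(R x) + (1 - ∫⁻ y, imhAcceptE w x y ∂(R x)) * B.indicator 1 x) :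
    Kernel.Invariant K (((gaussianReal 0 1).map e).withDensity fun x => ENNReal.ofReal (w x)) :=
  latentProposal_invariant hw hw0 e S (crankNicolson_isReversible hv hv0 S hS) R hR K hK

end Summit.Ventures.LatticeQCDFlow.Exactness
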